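import Literature.Analysis.Matrix.LocalisedResponse
import Literature.Analysis.Matrix.LocalisedVariation
import HarnessLib

/-!
# Localised response, IV: the CARD-FREE, TWO-PROFILE mixed response (the pointwise shape the one-loop rectangle consumes)

Topic `Literature/Analysis/Matrix`; namespace `Literature.Analysis.Matrix`.  Sequel of `LocalisedResponse.lean` (§4 `abs_mixedResponse_le`:
the mixed row `u + P·mₛ + A·mₛₜ = 0` ⟹ a GLOBAL bound `|mₛₜ| ≤ |n|·C·(μ + |n|·p·η·e^{θr}·e^{−θR})`, with two `Fintype.card` prefactors)
and `LocalisedVariation.lean` (`sum_ball_abs_le`).  Everything here is PROVED; no definitions, no named facts.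

THE POINT.  The one-loop trace rectangle `TraceInvMulMixedDifferenceOfResponse.trace_l1_hs_fourPt_inv_mul_le_of_response` asks for the
MIXED derivative of the background in the POINTWISE TWO-PROFILE form `|∂_σ∂_τU k| ≤ μ·e^{−θ(d k + d′ k)}` (localised near BOTH moved bonds),
with constants that are local sums, not `Fintype.card n`.  This file re-proves the mixed-response mechanism of [Balaban1985Variational] (10)
in exactly that currency:
* §1 ★`abs_mulVec_le_twoProfile_of_range_ball` — a range-`r` operator localised near one profile (`|P k l| ≤ p·e^{−θ·d′ k}`) applied to a
  vector localised near another (`|v l| ≤ η·e^{−θ·d l}`), with `r`-balls of cardinality `≤ B`: `|(P v) k| ≤ B·p·η·e^{θr}·e^{−θ(d′ k + d k)}`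
  (card-free edition of `abs_mulVec_le_of_range_expLocalised`).
* §2 ★`abs_mulVec_le_twoProfile_of_ctProfile` — a Combes–Thomas kernel (`|M k l| ≤ C·e^{−θ·dist k l}`) applied to a TWO-PROFILE vector
  (`|v l| ≤ ν·e^{−θ₁(d l + d′ l)}`) is two-profile localised at the same rate `θ₁`, provided `2θ₁ + θ₂ ≤ θ` where `θ₂` is the summability rate
  (`Σ_l e^{−θ₂·dist k l} ≤ S`): `|(M v) k| ≤ C·ν·S·e^{−θ₁(d k + d′ k)}` (split `θ·dist ≥ 2θ₁·dist + θ₂·dist` and the 1-Lipschitz rows of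
  `d, d′`).
* §3 ★★`abs_mixedResponse_le_twoProfile` — THE MIXED RESPONSE, card-free and pointwise: from the row `u + P·mₛ + A·mₛₜ = 0` with `det A` a unit,
  `|A⁻¹ k l| ≤ C·e^{−θ·dist k l}`, a two-profile explicit source `|u l| ≤ μ·e^{−θ₁(d l + d′ l)}`, `P` of range `r` with `|P k l| ≤ p·e^{−θ₁·d′ k}`,
  `|mₛ l| ≤ η·e^{−θ₁·d l}`, ball count `B`, `2θ₁ + θ₂ ≤ θ`, `Σ_l e^{−θ₂·dist k l} ≤ S`:
  `|mₛₜ k| ≤ C·S·(μ + B·p·η·e^{θ₁ r})·e^{−θ₁(d k + d′ k)}`.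

Consumer: cell `ym3-torus`, crux `FluctuationComparisonRegPrIntL`, DISCHARGE-SPEC §11 (xv): the row `bστ` of the one-loop capstone (the mixed
response of the background to the two coarse moves).  HONEST SCOPE: finite-dimensional linear algebra; nothing here bears on the Yang–Mills mass
gap (Clay), which is NOT proved.

References: T. Bałaban, CMP 102 (1985) 277, Thm 1 (10) p. 279 [Balaban1985Variational]; M. Aizenman, S. Warzel, *Random Operators* (2015)
§10.3 [AizenmanWarzel2015]; R. A. Horn, C. R. Johnson, *Matrix Analysis* (2013) §0.7, §5.6 [HornJohnson2013].
-/

noncomputable section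

open Matrix Finset
open scoped Matrix

namespace Literature.Analysis.Matrix

variable {n : Type*} [Fintype n] [DecidableEq n]

/-! ## §1 Range-`r` operator near one profile × vector near another, card-free -/

omit [DecidableEq n] in
/-- ★ **Card-free edition of `abs_mulVec_le_of_range_expLocalised`.**  `P k l ≠ 0 → dist k l ≤ r`, `|P k l| ≤ p·e^{−θ·d′ k}`,
`|v l| ≤ η·e^{−θ·d l}` with `d` 1-Lipschitz, `r`-balls `{l | dist k l ≤ r}` of cardinality `≤ B` ⟹
`|(P v) k| ≤ B·p·η·e^{θr}·e^{−θ·(d′ k + d k)}`. [cite: Balaban1985Variational, Thm 1 (10) p. 279] -/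
theorem abs_mulVec_le_twoProfile_of_range_ball (dist : n → n → ℕ) {P : Matrix n n ℝ} {p θ : ℝ} {r : ℕ} (hp : 0 ≤ p)
    (hθ : 0 ≤ θ) (hP0 : ∀ k l, P k l ≠ 0 → dist k l ≤ r) {d' : n → ℕ}
    (hPb : ∀ k l, |P k l| ≤ p * Real.exp (-(θ * d' k)))
    {d : n → ℕ} (hd : ∀ k l, d k ≤ dist k l + d l) {v : n → ℝ} {η : ℝ} (hη : 0 ≤ η)
    (hv : ∀ l, |v l| ≤ η * Real.exp (-(θ * d l)))
    {B : ℝ} (hB : ∀ k, ((univ.filter fun l => dist k l ≤ r).card : ℝ) ≤ B) (k : n) :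
    |(P *ᵥ v) k| ≤ B * p * η * Real.exp (θ * r) * Real.exp (-(θ * (d' k + d k))) := by
  rw [Matrix.mulVec, dotProduct]
  -- restrict the sum to the ball
  have hzero : ∀ l ∈ (univ : Finset n), l ∉ univ.filter (fun l => dist k l ≤ r) → P k l * v l = 0 := by
    intro l _ hl
    rw [Finset.mem_filter, not_and] at hl
    by_cases h0 : P k l = 0
    · rw [h0, zero_mul]
    · exact absurd (hP0 k l h0) (hl (Finset.mem_univ l))
  rw [← Finset.sum_subset (Finset.subset_univ _) hzero]
  refine (Finset.abs_sum_le_sum_abs _ _).trans ?_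
  have hterm : ∀ l ∈ univ.filter (fun l => dist k l ≤ r), |P k l * v l| ≤ p * Real.exp (-(θ * d' k)) * |v l| := by
    intro l _
    rw [abs_mul]
    exact mul_le_mul_of_nonneg_right (hPb k l) (abs_nonneg _)
  have hball := sum_ball_abs_le dist hθ hd hη hv k (hB k)
  calc ∑ l ∈ univ.filter (fun l => dist k l ≤ r), |P k l * v l|
      ≤ ∑ l ∈ univ.filter (fun l => dist k l ≤ r), p * Real.exp (-(θ * d' k)) * |v l| := Finset.sum_le_sum hterm
    _ = p * Real.exp (-(θ * d' k)) * ∑ l ∈ univ.filter (fun l => dist k l ≤ r), |v l| := by rw [Finset.mul_sum]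
    _ ≤ p * Real.exp (-(θ * d' k)) * (B * η * Real.exp (θ * r) * Real.exp (-(θ * d k))) :=
        mul_le_mul_of_nonneg_left hball (by positivity)
    _ = B * p * η * Real.exp (θ * r) * (Real.exp (-(θ * d' k)) * Real.exp (-(θ * d k))) := by ring
    _ = B * p * η * Real.exp (θ * r) * Real.exp (-(θ * (d' k + d k))) := by
        rw [← Real.exp_add]; ring_nf

/-! ## §2 Combes–Thomas kernel × two-profile vector -/

omit [DecidableEq n] in
/-- ★ **A Combes–Thomas kernel preserves two-profile localisation** (rate bookkeeping `2θ₁ + θ₂ ≤ θ`): `|M k l| ≤ C·e^{−θ·dist k l}`,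
`|v l| ≤ ν·e^{−θ₁·(d l + d′ l)}` with `d, d′` 1-Lipschitz, `θ₁ ≥ 0`, `2θ₁ + θ₂ ≤ θ`, `Σ_l e^{−θ₂·dist k l} ≤ S` ⟹
`|(M v) k| ≤ C·ν·S·e^{−θ₁·(d k + d′ k)}`. [cite: AizenmanWarzel2015, §10.3] -/
theorem abs_mulVec_le_twoProfile_of_ctProfile (dist : n → n → ℕ) {M : Matrix n n ℝ} {C θ θ₁ θ₂ : ℝ} (hC : 0 ≤ C)
    (hθ₁ : 0 ≤ θ₁) (hrate : 2 * θ₁ + θ₂ ≤ θ)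
    (hM : ∀ k l, |M k l| ≤ C * Real.exp (-(θ * dist k l)))
    {d d' : n → ℕ} (hd : ∀ k l, d k ≤ dist k l + d l) (hd' : ∀ k l, d' k ≤ dist k l + d' l)
    {v : n → ℝ} {ν : ℝ} (hν : 0 ≤ ν) (hv : ∀ l, |v l| ≤ ν * Real.exp (-(θ₁ * (d l + d' l))))
    {S : ℝ} (hS : ∀ k, ∑ l, Real.exp (-(θ₂ * dist k l)) ≤ S) (k : n) :
    |(M *ᵥ v) k| ≤ C * ν * S * Real.exp (-(θ₁ * (d k + d' k))) := by
  rw [Matrix.mulVec, dotProduct]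
  refine (Finset.abs_sum_le_sum_abs _ _).trans ?_
  have hterm : ∀ l, |M k l * v l| ≤ C * ν * Real.exp (-(θ₁ * (d k + d' k))) * Real.exp (-(θ₂ * dist k l)) := by
    intro l
    rw [abs_mul]
    have h1 : |M k l| * |v l| ≤ C * Real.exp (-(θ * dist k l)) * (ν * Real.exp (-(θ₁ * (d l + d' l)))) :=
      mul_le_mul (hM k l) (hv l) (abs_nonneg _) (mul_nonneg hC (Real.exp_nonneg _))
    refine h1.trans ?_
    have hdk : (d k : ℝ) ≤ dist k l + d l := by exact_mod_cast hd k l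
    have hdk' : (d' k : ℝ) ≤ dist k l + d' l := by exact_mod_cast hd' k l
    have hdist : (0 : ℝ) ≤ dist k l := Nat.cast_nonneg _
    have hexp : Real.exp (-(θ * dist k l)) * Real.exp (-(θ₁ * (d l + d' l))) ≤
        Real.exp (-(θ₁ * (d k + d' k))) * Real.exp (-(θ₂ * dist k l)) := by
      rw [← Real.exp_add, ← Real.exp_add]
      refine Real.exp_le_exp.2 ?_
      nlinarith [mul_le_mul_of_nonneg_left hdk hθ₁, mul_le_mul_of_nonneg_left hdk' hθ₁,
        mul_le_mul_of_nonneg_right hrate hdist]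
    calc C * Real.exp (-(θ * dist k l)) * (ν * Real.exp (-(θ₁ * (d l + d' l))))
        = C * ν * (Real.exp (-(θ * dist k l)) * Real.exp (-(θ₁ * (d l + d' l)))) := by ring
      _ ≤ C * ν * (Real.exp (-(θ₁ * (d k + d' k))) * Real.exp (-(θ₂ * dist k l))) :=
          mul_le_mul_of_nonneg_left hexp (mul_nonneg hC hν)
      _ = C * ν * Real.exp (-(θ₁ * (d k + d' k))) * Real.exp (-(θ₂ * dist k l)) := by ring
  calc ∑ l, |M k l * v l| ≤ ∑ l, C * ν * Real.exp (-(θ₁ * (d k + d' k))) * Real.exp (-(θ₂ * dist k l)) :=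
        Finset.sum_le_sum fun l _ => hterm l
    _ = C * ν * Real.exp (-(θ₁ * (d k + d' k))) * ∑ l, Real.exp (-(θ₂ * dist k l)) := by rw [Finset.mul_sum]
    _ ≤ C * ν * Real.exp (-(θ₁ * (d k + d' k))) * S := mul_le_mul_of_nonneg_left (hS k) (by positivity)
    _ = C * ν * S * Real.exp (-(θ₁ * (d k + d' k))) := by ring

/-! ## §3 The mixed response, card-free and two-profile -/

/-- ★★ **THE MIXED (SECOND-ORDER) RESPONSE, CARD-FREE AND POINTWISE TWO-PROFILE.**  From the mixed row `u + P·mₛ + A·mₛₜ = 0`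
(`det A` a unit) with Combes–Thomas decay `|A⁻¹ k l| ≤ C·e^{−θ·dist k l}`, an explicit mixed source localised near BOTH profiles
`|u l| ≤ μ·e^{−θ₁(d l + d′ l)}`, the Hessian's variation `P` of range `r` localised near the second profile `|P k l| ≤ p·e^{−θ₁·d′ k}`, the
first-order response localised near the first `|mₛ l| ≤ η·e^{−θ₁·d l}`, `r`-balls of cardinality `≤ B`, 1-Lipschitz `d, d′`, rates
`θ₁ ≥ 0`, `θ₂` with `2θ₁ + θ₂ ≤ θ` and `Σ_l e^{−θ₂·dist k l} ≤ S`: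
`|mₛₜ k| ≤ C·(μ + B·p·η·e^{θ₁ r})·S·e^{−θ₁·(d k + d′ k)}` — the mixed response of a stiff critical point to two distant local moves is
localised near both, with LOCAL constants. [cite: Balaban1985Variational, Thm 1 (10) p. 279] [cite: AizenmanWarzel2015, §10.3] -/
theorem abs_mixedResponse_le_twoProfile (dist : n → n → ℕ) {A P : Matrix n n ℝ} (hA : IsUnit A.det) {C θ θ₁ θ₂ : ℝ}
    (hC : 0 ≤ C) (hθ₁ : 0 ≤ θ₁) (hrate : 2 * θ₁ + θ₂ ≤ θ)
    (hinv : ∀ k l, |A⁻¹ k l| ≤ C * Real.exp (-(θ * dist k l)))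
    {u ms mst : n → ℝ} (hrow : u + P *ᵥ ms + A *ᵥ mst = 0)
    {d d' : n → ℕ} (hd : ∀ k l, d k ≤ dist k l + d l) (hd' : ∀ k l, d' k ≤ dist k l + d' l)
    {μ : ℝ} (hμ : 0 ≤ μ) (hu : ∀ l, |u l| ≤ μ * Real.exp (-(θ₁ * (d l + d' l))))
    {p : ℝ} {r : ℕ} (hp : 0 ≤ p) (hP0 : ∀ k l, P k l ≠ 0 → dist k l ≤ r) (hPb : ∀ k l, |P k l| ≤ p * Real.exp (-(θ₁ * d' k)))
    {η : ℝ} (hη : 0 ≤ η) (hms : ∀ l, |ms l| ≤ η * Real.exp (-(θ₁ * d l)))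
    {B : ℝ} (hB : ∀ k, ((univ.filter fun l => dist k l ≤ r).card : ℝ) ≤ B)
    {S : ℝ} (hS : ∀ k, ∑ l, Real.exp (-(θ₂ * dist k l)) ≤ S) (k : n) :
    |mst k| ≤ C * (μ + B * p * η * Real.exp (θ₁ * r)) * S * Real.exp (-(θ₁ * (d k + d' k))) := by
  have hB0 : 0 ≤ B := le_trans (Nat.cast_nonneg _) (hB k)
  have hrow' : (u + P *ᵥ ms) + A *ᵥ mst = 0 := hrow
  rw [response_eq_neg_inv_mulVec hA hrow', Pi.neg_apply, abs_neg]
  -- the source `u + P·mₛ` is two-profile localised with constant `μ + B·p·η·e^{θ₁ r}`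
  have hsrc : ∀ l, |(u + P *ᵥ ms) l| ≤ (μ + B * p * η * Real.exp (θ₁ * r)) * Real.exp (-(θ₁ * (d l + d' l))) := by
    intro l
    rw [Pi.add_apply]
    refine (abs_add_le _ _).trans ?_
    have h2 := abs_mulVec_le_twoProfile_of_range_ball dist hp hθ₁ hP0 hPb hd hη hms hB l
    rw [add_comm (d' l : ℝ) (d l)] at h2
    calc |u l| + |(P *ᵥ ms) l| ≤ μ * Real.exp (-(θ₁ * (d l + d' l))) +
          B * p * η * Real.exp (θ₁ * r) * Real.exp (-(θ₁ * (d l + d' l))) := add_le_add (hu l) h2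
      _ = (μ + B * p * η * Real.exp (θ₁ * r)) * Real.exp (-(θ₁ * (d l + d' l))) := by ring
  have h := abs_mulVec_le_twoProfile_of_ctProfile dist hC hθ₁ hrate hinv hd hd' (by positivity) hsrc hS k
  calc |(A⁻¹ *ᵥ (u + P *ᵥ ms)) k| ≤ C * (μ + B * p * η * Real.exp (θ₁ * r)) * S * Real.exp (-(θ₁ * (d k + d' k))) := h

end Literature.Analysis.Matrix

end
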